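import Mathlib
import Summits.QuantumFields.YangMills.Theses.ConvexGribovBody

/-!
# Sketch — crux-ideate r1 k2, crux stmt-QuantumFields-16404 (`ConvexGribovBody.BrascampLiebVacuumSC`)

Card `heat-bath-dominates-slice`: first-lemma signatures (no proofs, no skeleton).
The line: `HeatBathPoincareLargeToriSC` (transfer target C⁺ = the sibling core UP_SC on large tori)
`∧ SliceDirichletDomination` (first lemma; from `OneLinkSlopePoincare` + DLR exchangeability
`SusceptibilityToPoincare.Negative.lintegral_heatBath_update`) `∧ DmaxLowerBound` ⟹ the crux.
-/

open MeasureTheory Filter Topology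
open scoped BigOperators Matrix ComplexConjugate
open Literature.MathematicalPhysics.QuantumFieldTheory

namespace Summit.QuantumFields.YangMills.Cruxes.BrascampLiebVacuumSC.HeatBathDominatesSlice

/-- **Transfer target C⁺ (UP_SC on large tori).** For every SIMPLY-CONNECTED compact simple `G` and faithful
`r` there is `β₁` such that at every `β ≥ β₁` the torus Wilson measures satisfy the single-link HEAT-BATH
Poincaré inequality `Var F ≤ C(β) Σ_ℓ ∫∫ (F(U) − F(U[ℓ ↦ g]))² dν_ℓ^U dμ` for all bounded measurable `F`, with
one constant on all tori `S ≥ S₀(β)`. Body = hypothesis `h` of the landed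
`FiniteSusceptibilityWeakCoupling.finiteSusceptibilityWeakCoupling_of_heatBathPoincareOnLargeTori` with
`SimplyConnectedSpace G →` inserted (the ∀-G form is false at `SO(3)` modulo twist inputs:
`SusceptibilityToPoincare.Negative.Bottleneck`). -/
def HeatBathPoincareLargeToriSC : Prop :=
  ∀ (G : Type) [Group G] [TopologicalSpace G] [IsTopologicalGroup G] [CompactSpace G]
    [MeasurableSpace G] [BorelSpace G], IsCompactSimpleLieGroup G → SimplyConnectedSpace G →
    ∀ (r : LatticeRep G), ∃ β₁ : ℝ, ∀ β : ℝ, β₁ ≤ β → ∃ (C : ℝ) (S₀ : ℕ), ∀ S : ℕ, S₀ ≤ S →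
      ∀ F : GaugeConfig 4 (2 * S + 1) G → ℝ, Measurable F → (∃ M : ℝ, ∀ U, |F U| ≤ M) →
        ProbabilityTheory.variance F (wilsonMeasure (d := 4) (L := 2 * S + 1) r.ρ β) ≤
          C * ∑ ℓ : Edge 4 (2 * S + 1), ∫ U, ∫ g, (F U - F (Function.update U ℓ g)) ^ 2
            ∂((haarProbability G).tilted fun g' => -β * wilsonAction r.ρ (Function.update U ℓ g'))
            ∂(wilsonMeasure (d := 4) (L := 2 * S + 1) r.ρ β)

/-- **One-link metric-slope Poincaré inequality for the heat-bath law, uniform in the background** (the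
atomic input of the first lemma): for every `β` there is `Cℓ(G, r, β)` such that for every torus, every
configuration `U`, every link `ℓ` and every `φ : G → ℝ` Lipschitz for the Frobenius metric pulled back by
`r.ρ`, `Var_{ν_ℓ^U}(φ) ≤ Cℓ ∫ (metric slope of φ)² dν_ℓ^U`. Intended proof: Holley–Stroock bounded perturbation
(osc of `β S_W` in one link `≤ 12 N β`, so `Cℓ ≤ e^{12Nβ} · C_P(Haar)`) + Poincaré for Haar on the compact
connected Lie group with the (bi-Lipschitz equivalent) Riemannian upper gradient. False for finite `G`
(slopes are junk `0`), consistent with `Negative/FalseForFiniteGroups`. -/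
def OneLinkSlopePoincare : Prop :=
  ∀ (G : Type) [Group G] [TopologicalSpace G] [IsTopologicalGroup G] [CompactSpace G]
    [MeasurableSpace G] [BorelSpace G], IsCompactSimpleLieGroup G →
    ∀ (r : LatticeRep G) (β : ℝ), ∃ Cℓ : ℝ, 0 < Cℓ ∧ ∀ (S : ℕ) (U : GaugeConfig 4 (2 * S + 1) G)
      (ℓ : Edge 4 (2 * S + 1)) (φ : G → ℝ),
      (∃ K : ℝ, ∀ g g' : G, |φ g - φ g'| ≤ K * Real.sqrt (∑ a, ∑ b, ‖(r.ρ g - r.ρ g') a b‖ ^ 2)) →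
      let ν := (haarProbability G).tilted fun g' => -β * wilsonAction r.ρ (Function.update U ℓ g')
      let slopeφ : G → ℝ := fun g =>
        Filter.limsup (fun g' : G => |φ g' - φ g| / Real.sqrt (∑ a, ∑ b, ‖(r.ρ g' - r.ρ g) a b‖ ^ 2))
          (𝓝[≠] g)
      ∫ g, (φ g - ∫ g', φ g' ∂ν) ^ 2 ∂ν ≤ Cℓ * ∫ g, (slopeφ g) ^ 2 ∂ν

/-- **First lemma (SliceDirichletDomination).** For time-zero-local link-Lipschitz `f` the heat-bath Dirichlet
form of the 4D Wilson measure is dominated by the crux's metric-slope Dirichlet form on the time-zero spatial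
links: `Σ_ℓ ∫∫ (f(U) − f(U[ℓ ↦ g]))² dν_ℓ^U dμ ≤ Cℓ' · dir f`, `Cℓ' = 2 Cℓ(G, r, β)`, uniformly in `S`.
Proof sketch: links off the slice contribute `0` (locality (ii) is used exactly here); for a slice link,
DLR exchangeability (`lintegral_heatBath_update`, landed) gives `∫∫ (f(U) − f(U^{ℓ←g}))² = 2 E_μ Var_{ν_ℓ^U}`;
`OneLinkSlopePoincare` bounds each conditional variance by `Cℓ ∫ slope² dν_ℓ^U`; exchangeability again turns
`E_μ ∫ slope² dν_ℓ^U` into `∫ slope² dμ`, the `ℓ`-th summand of `dir f`. `slope`, `dir` verbatim from the crux. -/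
def SliceDirichletDomination : Prop :=
  ∀ (G : Type) [Group G] [TopologicalSpace G] [IsTopologicalGroup G] [CompactSpace G]
    [MeasurableSpace G] [BorelSpace G], IsCompactSimpleLieGroup G →
    ∀ (r : LatticeRep G) (β : ℝ), ∃ Cℓ' : ℝ, 0 < Cℓ' ∧ ∀ S : ℕ,
      let μ := wilsonMeasure (d := 4) (L := 2 * S + 1) r.ρ β
      let fro : Matrix (Fin r.N) (Fin r.N) ℂ → ℝ := fun M => ∑ a, ∑ b, ‖M a b‖ ^ 2
      let slope : (GaugeConfig 4 (2 * S + 1) G → ℝ) → GaugeConfig 4 (2 * S + 1) G →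
          Edge 4 (2 * S + 1) → ℝ := fun f U e =>
        Filter.limsup (fun g : G => |f (Function.update U e g) - f U| /
          Real.sqrt (fro (r.ρ g - r.ρ (U e)))) (𝓝[≠] (U e))
      let dir : (GaugeConfig 4 (2 * S + 1) G → ℝ) → ℝ := fun f =>
        ∑ e : Edge 4 (2 * S + 1), (if e.1 0 = 0 ∧ e.2 ≠ 0 then ∫ U, (slope f U e) ^ 2 ∂μ else 0)
      ∀ f : GaugeConfig 4 (2 * S + 1) G → ℝ,
        (∀ U V : GaugeConfig 4 (2 * S + 1) G,
          (∀ e : Edge 4 (2 * S + 1), e.1 0 = 0 → e.2 ≠ 0 → U e = V e) → f U = f V) →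
        (∃ K : ℝ, ∀ U V : GaugeConfig 4 (2 * S + 1) G,
          |f U - f V| ≤ K * ∑ e, Real.sqrt (fro (r.ρ (U e) - r.ρ (V e)))) →
        (∑ ℓ : Edge 4 (2 * S + 1), ∫ U, ∫ g, (f U - f (Function.update U ℓ g)) ^ 2
            ∂((haarProbability G).tilted fun g' => -β * wilsonAction r.ρ (Function.update U ℓ g')) ∂μ)
          ≤ Cℓ' * dir f

/-- **Support stub DmaxLowerBound** (the refuter's "hidden requirement", needed by EVERY line of this crux once
`∃ C` sits before `∀ S`): at fixed `β > 0` the covariance scale `Dmax(β, S)` of the crux is bounded BELOW by a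
positive `d(β)` on all large tori. Physics: `Dmax ≥ avg_p D(p) = 3 E‖A_link‖²_F ≍ dim G / β` (Parseval);
the rigorous point is that the crude lattice gluon field `A = (M − Mᴴ)/2` also vanishes at involutions, so the
bound is probabilistic (desk toy `toys/dmax_lower_su2.py`: at Coulomb maximisers `avg‖A‖²/avg plaquette
deficit ≈ 0.32–0.45` on generic classes but `0.10` with one centre defect). `Dmax` verbatim from the crux. -/
def DmaxLowerBound : Prop :=
  ∀ (G : Type) [Group G] [TopologicalSpace G] [IsTopologicalGroup G] [CompactSpace G]
    [MeasurableSpace G] [BorelSpace G], IsCompactSimpleLieGroup G →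
    ∀ (r : LatticeRep G) (β : ℝ), 0 < β → ∃ d : ℝ, 0 < d ∧ ∃ S₀ : ℕ, ∀ S : ℕ, S₀ ≤ S →
      let μ := wilsonMeasure (d := 4) (L := 2 * S + 1) r.ρ β
      let fro : Matrix (Fin r.N) (Fin r.N) ℂ → ℝ := fun M => ∑ a, ∑ b, ‖M a b‖ ^ 2
      let coul : GaugeConfig 4 (2 * S + 1) G → (Site 4 (2 * S + 1) → G) → ℝ := fun U h =>
        -∑ e : Edge 4 (2 * S + 1),
          (if e.1 0 = 0 ∧ e.2 ≠ 0 then (r.ρ (gaugeTransform h U e)).trace.re else 0)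
      let cov : GaugeConfig 4 (2 * S + 1) G → (Site 4 (2 * S + 1) → G) →
          (Fin 3 → ZMod (2 * S + 1)) → ℝ := fun U h p =>
        (∑ j : Fin 3, fro (∑ y : Fin 3 → ZMod (2 * S + 1),
          Complex.exp (-(2 * Real.pi * Complex.I *
            (∑ i : Fin 3, ((p i).val : ℂ) * ((y i).val : ℂ)) / (2 * S + 1 : ℂ))) •
          ((1 / 2 : ℂ) • (r.ρ (gaugeTransform h U (Fin.cons (0 : ZMod (2 * S + 1)) y, j.succ)) -
            (r.ρ (gaugeTransform h U (Fin.cons (0 : ZMod (2 * S + 1)) y, j.succ)))ᴴ)))) /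
          ((2 * S + 1 : ℝ) ^ 3)
      let Dmax : ℝ := ⨆ p : Fin 3 → ZMod (2 * S + 1),
        ∫ U, (⨆ h : {h : Site 4 (2 * S + 1) → G // ∀ h', coul U h ≤ coul U h'}, cov U h.1 p) ∂μ
      d ≤ Dmax

/-- **Shape of the line** (pure bookkeeping once the three inputs are in hand: admissible `f` are continuous on
a compact metrisable space, hence bounded and Borel; `variance = ∫ (f − ∫ f)²`; then
`Var ≤ C·Σ_ℓ∫∫ ≤ C·Cℓ'·dir f ≤ (C·Cℓ'/d)·Dmax·dir f`). Recorded as a `Prop`, not claimed. -/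
def LineShape : Prop :=
  HeatBathPoincareLargeToriSC → SliceDirichletDomination → DmaxLowerBound →
    Summit.QuantumFields.YangMills.Theses.ConvexGribovBody.BrascampLiebVacuumSC

end Summit.QuantumFields.YangMills.Cruxes.BrascampLiebVacuumSC.HeatBathDominatesSlice
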